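import Summits.CriticalPhenomena.SAWScalingLimit.Theses.SAWRenewalTightness
import Literature.Probability.RandomPlanarGeometry.LocalMartingaleProofs
import Literature.Probability.RandomPlanarGeometry.SAWSideProbability

/-!
# Necessity of crux `SubseqIdentification` (stmt-CriticalPhenomena-0783) and what its hypotheses give for free

Positive by-products of the disprover's cycle 1 (refuter; support lemmas for the shared crux
`Summit.CriticalPhenomena.SAWScalingLimit.Theses.SAWRenewalTightness.SubseqIdentification`):
* `subseqIdentification_of_sawScalingLimit` — the crux FOLLOWS from the summit conjunct
  `SAW.SAWScalingLimit` (uniqueness of weak limits on the metric space `CurveClass ℂ`), so a refutation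
  of the crux would refute the Lawler–Schramm–Werner conjecture as typed;
* `SAW.law` is a probability measure or `0`; the test integral of `f ≡ 1` alone forces the laws along the
  sequence to be probability measures and the endpoints to be joined eventually (so
  `IsEndpointApprox.reachable` is never needed in a proof of the crux);
* `ae_endpoints_of_hyps` — every subsequential limit `μ` a.s. starts at `a = D.pt 0` and ends at
  `b = D.pt 1`, the cheap necessary condition of `IsSLELaw` (`IsSLELaw.ae_endpoints`).
-/

noncomputable section

open Literature.Probability.RandomPlanarGeometry Literature.Probability.RandomPlanarGeometry.SAW
  Literature.Probability.LatticeModels Literature.Probability.Percolation Literature.Probability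
  MeasureTheory Filter Topology Set
open scoped NNReal ENNReal BoundedContinuousFunction

namespace Summit.CriticalPhenomena.SAWScalingLimit.Theorems.SubseqIdentification.Negative


open Summit.CriticalPhenomena.SAWScalingLimit.Theses.SAWRenewalTightness in
/-- **The crux is NECESSARY for the conjunct.** `SAWScalingLimit → SubseqIdentification`: if the
critical SAW laws converge in law to chordal SLE_{8/3} along `𝓝[>] 0`, then along any `s n → 0⁺`
every weak limit `μ` IS that SLE law (uniqueness of weak limits of finite measures on the metric
space `CurveClass ℂ`, `ext_of_forall_integral_eq_of_IsFiniteMeasure`; the pre-Wiener measure is a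
probability measure unconditionally, `isProbabilityMeasure_preWienerMeasure'`). CONSEQUENCE FOR THE
DISPROVER: a kill of this crux is a kill of `SAW.SAWScalingLimit` itself (the LSW conjecture as
typed), i.e. of every SAW route at once — there is no slack between the crux and the summit conjunct
on the identification side. [folklore] -/
theorem subseqIdentification_of_sawScalingLimit (h : SAW.SAWScalingLimit) : SubseqIdentification := by
  intro D a b hab s μ hs hμ hlim
  obtain ⟨Γ, hΓ, -, hT⟩ := h D a b hab
  haveI := isProbabilityMeasure_preWienerMeasure'
  haveI : IsProbabilityMeasure (Process.preWienerMeasure.map Γ) :=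
    Measure.isProbabilityMeasure_map hΓ.aemeasurable
  have key : μ = Process.preWienerMeasure.map Γ := by
    apply ext_of_forall_integral_eq_of_IsFiniteMeasure
    intro f
    rw [integral_map hΓ.aemeasurable f.continuous.aestronglyMeasurable]
    exact tendsto_nhds_unique (hlim f) ((hT f).comp hs)
  exact ⟨Γ, hΓ, key⟩

open Summit.CriticalPhenomena.SAWScalingLimit.Theses.SAWRenewalTightness in
/-- Contrapositive, for the record: refuting the crux refutes the summit conjunct. [folklore] -/
theorem not_sawScalingLimit_of_not_subseqIdentification (h : ¬ SubseqIdentification) :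
    ¬ SAW.SAWScalingLimit := fun h' => h (subseqIdentification_of_sawScalingLimit h')

/-- Dichotomy: `SAW.law` is a probability measure or the zero measure (its total mass
`Z⁻¹ · Z` is `1`, or `0` in the junk regimes `Z = 0`, `Z = ∞`) — no finiteness argument needed.
(Mass form: `SimpleSubseqLimits.Negative.law_univ_eq_zero_or_one`.) [folklore] -/
theorem isProbabilityMeasure_law_or_eq_zero (Ω : Set ℂ) (δ : ℝ) (a b : Site 2) :
    IsProbabilityMeasure (law Ω δ a b) ∨ law Ω δ a b = 0 := by
  have hmass : law Ω δ a b univ = 0 ∨ law Ω δ a b univ = 1 := by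
    rw [law, Measure.smul_apply, smul_eq_mul]
    rcases eq_or_ne (weight Ω δ a b univ) 0 with h0 | h0
    · left; rw [h0, mul_zero]
    rcases eq_or_ne (weight Ω δ a b univ) ⊤ with ht | ht
    · left; rw [ht, ENNReal.inv_top, zero_mul]
    · right; exact ENNReal.inv_mul_cancel h0 ht
  rcases hmass with h | h
  · exact Or.inr (Measure.measure_univ_eq_zero.1 h)
  · exact Or.inl ⟨h⟩

/-- A probability SAW law has joined endpoints (else the space of SAWs is empty and the law is
`0`). [folklore] -/
theorem reachable_of_isProbabilityMeasure_law {Ω : Set ℂ} {δ : ℝ} {a b : Site 2}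
    (h : IsProbabilityMeasure (law Ω δ a b)) : (discreteDomainGraph Ω δ).Reachable a b := by
  by_contra hr
  haveI : IsEmpty (DomainSAW Ω δ a b) := ⟨fun γ => hr γ.walk.reachable⟩
  have h0 : law Ω δ a b univ = 0 := by
    rw [Set.univ_eq_empty_iff.2 ‹_›, measure_empty]
  have h1 : law Ω δ a b univ = 1 := measure_univ
  exact zero_ne_one (h0.symm.trans h1)

/-- **The hypothesis `IsEndpointApprox.reachable` is redundant along the sequence**: convergence of
the test integral of `f ≡ 1` to a probability limit forces the laws to be probability measures
eventually (their mass is `0` or `1` and tends to `1`). [folklore] -/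
theorem eventually_isProbabilityMeasure_of_tendsto {Ω : Set ℂ} {a b : ℝ → Site 2} {s : ℕ → ℝ}
    {μ : Measure (CurveClass ℂ)} [IsProbabilityMeasure μ]
    (hlim : Tendsto (fun n => ∫ γ, (1 : CurveClass ℂ →ᵇ ℝ) γ.curve
      ∂(law Ω (s n) (a (s n)) (b (s n)))) atTop (𝓝 (∫ x, (1 : CurveClass ℂ →ᵇ ℝ) x ∂μ))) :
    ∀ᶠ n in atTop, IsProbabilityMeasure (law Ω (s n) (a (s n)) (b (s n))) := by
  simp only [BoundedContinuousFunction.coe_one, Pi.one_apply, integral_const, smul_eq_mul,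
    mul_one, probReal_univ] at hlim
  have hev := hlim.eventually (lt_mem_nhds (show (1 : ℝ) / 2 < 1 by norm_num))
  filter_upwards [hev] with n hn
  rcases isProbabilityMeasure_law_or_eq_zero Ω (s n) (a (s n)) (b (s n)) with h | h
  · exact h
  · exfalso
    rw [h] at hn
    simp at hn
    linarith

/-- … hence the endpoints are eventually joined along the sequence, with no appeal to
`IsEndpointApprox.reachable`. [folklore] -/
theorem eventually_reachable_of_tendsto {Ω : Set ℂ} {a b : ℝ → Site 2} {s : ℕ → ℝ}
    {μ : Measure (CurveClass ℂ)} [IsProbabilityMeasure μ]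
    (hlim : Tendsto (fun n => ∫ γ, (1 : CurveClass ℂ →ᵇ ℝ) γ.curve
      ∂(law Ω (s n) (a (s n)) (b (s n)))) atTop (𝓝 (∫ x, (1 : CurveClass ℂ →ᵇ ℝ) x ∂μ))) :
    ∀ᶠ n in atTop, (discreteDomainGraph Ω (s n)).Reachable (a (s n)) (b (s n)) :=
  (eventually_isProbabilityMeasure_of_tendsto hlim).mono fun _ h =>
    reachable_of_isProbabilityMeasure_law h

/-- Every SAW curve starts at the mesh point of its first vertex. [folklore] -/
theorem source_curve {Ω : Set ℂ} {δ : ℝ} {a b : Site 2} (γ : DomainSAW Ω δ a b) :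
    γ.curve.source = meshPoint δ a := by
  rw [DomainSAW.curve, CurveClass.source_mk, Curve.source_def]
  exact SimpleGraph.Walk.toCurve_apply_zero _ _

/-- Every SAW curve ends at the mesh point of its last vertex. [folklore] -/
theorem target_curve {Ω : Set ℂ} {δ : ℝ} {a b : Site 2} (γ : DomainSAW Ω δ a b) :
    γ.curve.target = meshPoint δ b := by
  rw [DomainSAW.curve, CurveClass.target_mk, Curve.target_def]
  exact SimpleGraph.Walk.toCurve_apply_one _ _

/-- Abstract endpoint lemma: if a continuous functional `e` is CONSTANT `= q n` on the support of
the `n`-th law (all SAW curves share their endpoints) with `q n → p`, then `e = p` a.e. for the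
weak limit. [folklore] -/
theorem ae_eq_of_tendsto {Ω : Set ℂ} {a b : ℝ → Site 2} {s : ℕ → ℝ} {p : ℂ} {q : ℕ → ℂ}
    {e : CurveClass ℂ → ℂ} (he : Continuous e)
    (hq : ∀ n (γ : DomainSAW Ω (s n) (a (s n)) (b (s n))), e γ.curve = q n)
    (hqp : Tendsto q atTop (𝓝 p))
    {μ : Measure (CurveClass ℂ)} [IsProbabilityMeasure μ]
    (hlim : ∀ f : CurveClass ℂ →ᵇ ℝ, Tendsto (fun n => ∫ γ, f γ.curve
      ∂(law Ω (s n) (a (s n)) (b (s n)))) atTop (𝓝 (∫ x, f x ∂μ))) :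
    ∀ᵐ γ ∂μ, e γ = p := by
  -- the truncated distance test function `γ ↦ min 1 (dist (e γ) p)`
  set F : CurveClass ℂ →ᵇ ℝ := BoundedContinuousFunction.mkOfBound
    ⟨fun γ => min 1 (dist (e γ) p), continuous_const.min (he.dist continuous_const)⟩ 1
    (fun γ γ' => by
      simp only [ContinuousMap.coe_mk, Real.dist_eq]
      have h1 : 0 ≤ min 1 (dist (e γ) p) := le_min zero_le_one dist_nonneg
      have h2 : min 1 (dist (e γ) p) ≤ 1 := min_le_left _ _
      have h3 : 0 ≤ min 1 (dist (e γ') p) := le_min zero_le_one dist_nonneg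
      have h4 : min 1 (dist (e γ') p) ≤ 1 := min_le_left _ _
      rw [abs_le]; constructor <;> linarith) with hF
  have hFapply : ∀ γ, F γ = min 1 (dist (e γ) p) := fun γ => rfl
  have h1 : ∀ n, ∫ γ, F γ.curve ∂(law Ω (s n) (a (s n)) (b (s n))) =
      (law Ω (s n) (a (s n)) (b (s n))).real univ * min 1 (dist (q n) p) := by
    intro n
    have : (fun γ : DomainSAW Ω (s n) (a (s n)) (b (s n)) => F γ.curve) =
        fun _ => min 1 (dist (q n) p) := by
      funext γ; rw [hFapply, hq n γ]
    rw [this, integral_const, smul_eq_mul]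
  have hmass : ∀ n, 0 ≤ (law Ω (s n) (a (s n)) (b (s n))).real univ ∧
      (law Ω (s n) (a (s n)) (b (s n))).real univ ≤ 1 := by
    intro n
    refine ⟨ENNReal.toReal_nonneg, ?_⟩
    rcases isProbabilityMeasure_law_or_eq_zero Ω (s n) (a (s n)) (b (s n)) with h | h
    · rw [probReal_univ]
    · simp [h]
  have h0 : Tendsto (fun n => ∫ γ, F γ.curve ∂(law Ω (s n) (a (s n)) (b (s n)))) atTop (𝓝 0) := by
    have hd : Tendsto (fun n => min 1 (dist (q n) p)) atTop (𝓝 0) := by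
      have hc : Continuous fun z : ℂ => min (1 : ℝ) (dist z p) :=
        continuous_const.min (continuous_id.dist continuous_const)
      have h := (hc.tendsto p).comp hqp
      rw [dist_self, min_eq_right zero_le_one] at h
      exact h
    refine squeeze_zero (fun n => ?_) (fun n => ?_) hd
    · rw [h1]; exact mul_nonneg (hmass n).1 (le_min zero_le_one dist_nonneg)
    · rw [h1]
      calc (law Ω (s n) (a (s n)) (b (s n))).real univ * min 1 (dist (q n) p)
          ≤ 1 * min 1 (dist (q n) p) :=
            mul_le_mul_of_nonneg_right (hmass n).2 (le_min zero_le_one dist_nonneg)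
        _ = min 1 (dist (q n) p) := one_mul _
  have hint : ∫ x, F x ∂μ = 0 := tendsto_nhds_unique (hlim F) h0
  have hae : (fun x => F x) =ᵐ[μ] 0 :=
    (integral_eq_zero_iff_of_nonneg
      (fun x => show (0 : CurveClass ℂ → ℝ) x ≤ F x from le_min zero_le_one dist_nonneg)
      (F.integrable μ)).1 hint
  filter_upwards [hae] with γ hγ
  have hγ' : min 1 (dist (e γ) p) = 0 := by rw [← hFapply]; exact hγ
  rcases min_eq_iff.1 hγ' with ⟨h, -⟩ | ⟨h, -⟩
  · exact absurd h one_ne_zero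
  · exact dist_eq_zero.1 h

/-- **The cheap necessary conditions of `IsSLELaw` are automatic for subsequential limits**: under
the hypotheses of the crux, `μ`-a.e. curve class starts at `a = D.pt 0` and ends at `b = D.pt 1`
(exactly what `IsSLELaw.ae_endpoints` demands of an SLE law). So no endpoint-based obstruction — the
only kind §1–§2 could manufacture — refutes the crux; a refutation must see the interior geometry of
the limit (simplicity, boundary avoidance, restriction, conformal covariance), i.e. a genuine
estimate on critical SAW. [folklore] -/
theorem ae_endpoints_of_hyps {D : DobrushinDomain} {a b : ℝ → Site 2} (hab : IsEndpointApprox D a b)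
    {s : ℕ → ℝ} (hs : Tendsto s atTop (𝓝[>] (0 : ℝ))) {μ : Measure (CurveClass ℂ)}
    [IsProbabilityMeasure μ]
    (hlim : ∀ f : CurveClass ℂ →ᵇ ℝ, Tendsto (fun n => ∫ γ, f γ.curve
      ∂(law D.carrier (s n) (a (s n)) (b (s n)))) atTop (𝓝 (∫ x, f x ∂μ))) :
    ∀ᵐ γ ∂μ, γ.source = D.pt 0 ∧ γ.target = D.pt 1 := by
  have h1 : ∀ᵐ γ ∂μ, γ.source = D.pt 0 :=
    ae_eq_of_tendsto CurveClass.continuous_source (q := fun n => meshPoint (s n) (a (s n)))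
      (fun n γ => source_curve γ) (hab.tendsto_fst.comp hs) hlim
  have h2 : ∀ᵐ γ ∂μ, γ.target = D.pt 1 :=
    ae_eq_of_tendsto CurveClass.continuous_target (q := fun n => meshPoint (s n) (b (s n)))
      (fun n γ => target_curve γ) (hab.tendsto_snd.comp hs) hlim
  filter_upwards [h1, h2] with γ hγ1 hγ2
  exact ⟨hγ1, hγ2⟩

/-- The trace of the polyline of a trivial walk is its base point (re-hosted from
`Percolation/CLE6Proofs.lean`, not imported here). [folklore] -/
theorem walk_range_toCurve_nil {V E : Type*} [AddCommGroup E] [Module ℝ E] [TopologicalSpace E]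
    [ContinuousAdd E] [ContinuousSMul ℝ E] {G : SimpleGraph V} (emb : V → E) (u : V) :
    Set.range ((SimpleGraph.Walk.nil : G.Walk u u).toCurve emb) = {emb u} := by
  simp [SimpleGraph.Walk.toCurve, polyline]

/-- The trace of the polyline of `cons h p` is the first segment followed by the trace of `p`
(re-hosted from `Percolation/CLE6Proofs.lean`). [folklore] -/
theorem walk_range_toCurve_cons {V E : Type*} [AddCommGroup E] [Module ℝ E] [TopologicalSpace E]
    [ContinuousAdd E] [ContinuousSMul ℝ E] {G : SimpleGraph V} (emb : V → E) {u v w : V}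
    (h : G.Adj u v) (p : G.Walk v w) :
    Set.range ((SimpleGraph.Walk.cons h p).toCurve emb) =
      segment ℝ (emb u) (emb v) ∪ Set.range (p.toCurve emb) := by
  cases p <;> simp [SimpleGraph.Walk.toCurve, polyline, Path.trans_range, Path.range_segment]

/-- The trace of the polyline of a walk lies in any set containing the embedded base vertex and the
closed segment of every dart (re-hosted from `Percolation/CLE6Proofs.lean`). [folklore] -/
theorem walk_range_toCurve_subset {V E : Type*} [AddCommGroup E] [Module ℝ E] [TopologicalSpace E]
    [ContinuousAdd E] [ContinuousSMul ℝ E] {G : SimpleGraph V} {S : Set E} {emb : V → E} :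
    ∀ {u v : V} (p : G.Walk u v), emb u ∈ S →
      (∀ d ∈ p.darts, segment ℝ (emb d.fst) (emb d.snd) ⊆ S) → Set.range (p.toCurve emb) ⊆ S
  | _, _, SimpleGraph.Walk.nil, hu, _ => by
    rw [walk_range_toCurve_nil]
    exact Set.singleton_subset_iff.2 hu
  | _, _, SimpleGraph.Walk.cons h p, _, hd => by
    rw [walk_range_toCurve_cons]
    rw [SimpleGraph.Walk.darts_cons] at hd
    have h1 := hd _ List.mem_cons_self
    exact Set.union_subset h1 (walk_range_toCurve_subset p (h1 (right_mem_segment ℝ _ _))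
      fun d hd' => hd d (List.mem_cons_of_mem _ hd'))

/-- **SAW polylines between distinct endpoints lie in `Ω̄`**: every edge of `Ω_δ` is a closed
segment of `closure Ω` (`meshGraph_adj_iff`), and a walk between distinct vertices starts with an
edge. (For `a = b` the trivial walk at a junk vertex `a ∉ Ω_δ` would escape; excluded below because
the endpoints are eventually distinct.) [folklore] -/
theorem range_curve_subset_closure {Ω : Set ℂ} {δ : ℝ} {a b : Site 2} (hab : a ≠ b)
    (γ : DomainSAW Ω δ a b) : γ.curve.range ⊆ closure Ω := by
  have hd : ∀ d ∈ γ.walk.darts, segment ℝ (meshPoint δ d.fst) (meshPoint δ d.snd) ⊆ closure Ω :=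
    fun d _ => (meshGraph_adj_iff.1 (discreteDomainGraph_le_meshGraph Ω δ d.adj)).2
  obtain ⟨w, hw⟩ := γ
  cases w with
  | nil => exact absurd rfl hab
  | cons h q =>
    rintro _ ⟨t, rfl⟩
    refine walk_range_toCurve_subset (SimpleGraph.Walk.cons h q)
      ((meshGraph_adj_iff.1 (discreteDomainGraph_le_meshGraph Ω δ h)).2 (left_mem_segment ℝ _ _))
      hd ⟨t, rfl⟩

/-- Under the endpoint hypothesis the lattice endpoints are eventually DISTINCT along the sequence
(`δ·a δ → a ≠ b ← δ·b δ`, `MarkedDomain.pt_injective`). [folklore] -/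
theorem eventually_ne_of_hyps {D : DobrushinDomain} {a b : ℝ → Site 2} (hab : IsEndpointApprox D a b)
    {s : ℕ → ℝ} (hs : Tendsto s atTop (𝓝[>] (0 : ℝ))) : ∀ᶠ n in atTop, a (s n) ≠ b (s n) := by
  have hpt : D.pt 0 ≠ D.pt 1 := fun h => absurd (D.pt_injective h) (by decide)
  obtain ⟨U, V, hU, hV, h0, h1, hUV⟩ := t2_separation hpt
  have h0' : ∀ᶠ n in atTop, meshPoint (s n) (a (s n)) ∈ U :=
    (hab.tendsto_fst.comp hs) (hU.mem_nhds h0)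
  have h1' : ∀ᶠ n in atTop, meshPoint (s n) (b (s n)) ∈ V :=
    (hab.tendsto_snd.comp hs) (hV.mem_nhds h1)
  filter_upwards [h0', h1'] with n hn0 hn1 heq
  rw [heq] at hn0
  exact Set.disjoint_left.1 hUV hn0 hn1

/-- **Subsequential limits are supported on curves in `D̄`** (the third clause of
`IsSLELaw.ae_endpoints` is also automatic): the truncated distance to the closed nonempty set
`rangeSubset (closure D)` is a test function vanishing on every SAW curve between distinct
endpoints. [folklore] -/
theorem ae_range_subset_closure_of_hyps {D : DobrushinDomain} {a b : ℝ → Site 2}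
    (hab : IsEndpointApprox D a b) {s : ℕ → ℝ} (hs : Tendsto s atTop (𝓝[>] (0 : ℝ)))
    {μ : Measure (CurveClass ℂ)} [IsProbabilityMeasure μ]
    (hlim : ∀ f : CurveClass ℂ →ᵇ ℝ, Tendsto (fun n => ∫ γ, f γ.curve
      ∂(law D.carrier (s n) (a (s n)) (b (s n)))) atTop (𝓝 (∫ x, f x ∂μ))) :
    ∀ᵐ γ ∂μ, γ.range ⊆ closure D.carrier := by
  set F : Set (CurveClass ℂ) := CurveClass.rangeSubset (closure D.carrier) with hF
  have hFc : IsClosed F := CurveClass.isClosed_rangeSubset isClosed_closure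
  obtain ⟨z, hz⟩ := D.nonempty
  have hFne : F.Nonempty := by
    refine ⟨CurveClass.mk (Curve.const z), ?_⟩
    rw [hF, CurveClass.mem_rangeSubset, CurveClass.range_mk]
    rintro _ ⟨t, rfl⟩
    exact subset_closure hz
  -- test function: truncated distance to `F`
  set φ : CurveClass ℂ →ᵇ ℝ := BoundedContinuousFunction.mkOfBound
    ⟨fun γ => min 1 (Metric.infDist γ F), continuous_const.min (Metric.continuous_infDist_pt F)⟩ 1
    (fun γ γ' => by
      simp only [ContinuousMap.coe_mk, Real.dist_eq]
      have h1 : 0 ≤ min 1 (Metric.infDist γ F) := le_min zero_le_one Metric.infDist_nonneg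
      have h2 : min 1 (Metric.infDist γ F) ≤ 1 := min_le_left _ _
      have h3 : 0 ≤ min 1 (Metric.infDist γ' F) := le_min zero_le_one Metric.infDist_nonneg
      have h4 : min 1 (Metric.infDist γ' F) ≤ 1 := min_le_left _ _
      rw [abs_le]; constructor <;> linarith) with hφdef
  have hφ : ∀ γ, φ γ = min 1 (Metric.infDist γ F) := fun _ => rfl
  have hint0 : ∀ᶠ n in atTop, ∫ γ, φ γ.curve ∂(law D.carrier (s n) (a (s n)) (b (s n))) = 0 :=
    (eventually_ne_of_hyps hab hs).mono fun n hn => by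
      have : (fun γ : DomainSAW D.carrier (s n) (a (s n)) (b (s n)) => φ γ.curve) = fun _ => 0 :=
        funext fun γ => by
          have hmem : γ.curve ∈ F := by
            rw [hF, CurveClass.mem_rangeSubset]; exact range_curve_subset_closure hn γ
          rw [hφ, Metric.infDist_zero_of_mem hmem, min_eq_right zero_le_one]
      rw [this, integral_zero]
  have hlim0 : Tendsto (fun n => ∫ γ, φ γ.curve ∂(law D.carrier (s n) (a (s n)) (b (s n)))) atTop
      (𝓝 0) :=
    tendsto_const_nhds.congr' (hint0.mono fun n hn => hn.symm)
  have hint : ∫ x, φ x ∂μ = 0 := tendsto_nhds_unique (hlim φ) hlim0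
  have hae : (fun x => φ x) =ᵐ[μ] 0 :=
    (integral_eq_zero_iff_of_nonneg
      (fun x => show (0 : CurveClass ℂ → ℝ) x ≤ φ x from le_min zero_le_one Metric.infDist_nonneg)
      (φ.integrable μ)).1 hint
  filter_upwards [hae] with γ hγ
  have h0 : min 1 (Metric.infDist γ F) = 0 := by rw [← hφ]; exact hγ
  have hdist : Metric.infDist γ F = 0 := by
    rcases min_eq_iff.1 h0 with ⟨h, -⟩ | ⟨h, -⟩
    · exact absurd h one_ne_zero
    · exact h
  have hmem : γ ∈ F := (hFc.mem_iff_infDist_zero hFne).2 hdist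
  rw [hF, CurveClass.mem_rangeSubset] at hmem
  exact hmem

end Summit.CriticalPhenomena.SAWScalingLimit.Theorems.SubseqIdentification.Negative
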